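import Mathlib
import HarnessLib
import Summits.NavierStokesRegularity.NavierStokesRegularity.Theorems.TaoLadderRungThreeGappedFrontRobustTailStep
import Summits.NavierStokesRegularity.NavierStokesRegularity.Theorems.CompletionRelayChainRelayFrontStepFlux

/-!
# `CompletionRelayChain` — crux `RelayFrontStep` (item stmt-NavierStokesRegularity-24850):
  THE RELAY TAIL STEP — one-directional Bihari step with the relay flux (helper for LINE `window_v2`,
  stub `stub_tail`)

The tree's one-directional tail step (`GappedFrontRobust.pseudoFlowOn_sqrt_shell_energy_le_tail`)
bounds `√(Σᵢ F_{i,K})` along a pseudo-flow by the start energy above the bond `K−1 | K` plus the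
time-integrated GENERIC bond flux `(Σ|α_{·,(0,0,1)}|)·Λ_{K−1}·P²`, `P ≥` ALL amplitudes of shell `K−1`.
For the completion-relay lattice the bond flux is the RELAY FLUX (`RelayFrontStep.botSum_eq_relayFlux`,
`…abs_botSum_relay_le`): it sees only the trigger and the relay of the lower shell. This file proves
the corresponding step, on an initial window `[0, t] ⊆ [0, τ]` and with an arbitrary continuous
majorant `g ≥ Λ_{K−1}(u_{K−1}² + |r_{K−1}u_{K−1}|/32)`:

  `√(Σᵢ F_{i,K}(s)) ≤ √E₀ + ½ ∫₀ˢ √2 · g`      (`relay_tail_step`)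

— so that behind an ACTIVE shell (old shell 2 of the hop: carrier `0.09`, trigger `≤ 2e-6`) the
first tail shell is controlled by `∫u₂²` and `∫|r₂u₂|` alone (census
`Cruxes/RelayFrontStep/REPAIR-CENSUS-crc-p1.md` §4, S2), and further out by the previous shell's energy
(`relay_tail_step_of_energy_le`: `g` constant `= Λ_{K−1}·(65/32)·β` when `Σᵢ F_{i,K−1} ≤ β`).

No definitions. HONEST FRAMING: elementary real analysis of MODEL lattice pseudo-flows (Tao 2016 §4
(4.5), (4.9)–(4.10) with (4.3)); helper for the crux, no stub credit; nothing here is a statement about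
the Navier–Stokes equations; no summit, rung or crux is proved.
-/

noncomputable section

-- the summit-side namespace `Summit.NavierStokesRegularity.NavierStokesRegularity.…` (single-conjunct summit,
-- D-0017) repeats a component by design; the dupNamespace linter would flag every declaration.
set_option linter.dupNamespace false

open Set MeasureTheory intervalIntegral Literature.Analysis.FluidPDE Literature.Analysis.FluidPDE.TaoCascade
open Summit.NavierStokesRegularity.NavierStokesRegularity.Theorems.GappedFrontRobust

namespace Summit.NavierStokesRegularity.NavierStokesRegularity.Theorems

namespace RelayFrontStep

variable {τ κ₁ κ₂ : ℝ} {α : Fin 4 → Fin 4 → Fin 4 → ℤ × ℤ × ℤ → ℝ}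
  {S₀ F₀ B₀ : Fin 4 → ℤ → ℝ} {S F : Fin 4 → ℤ → ℝ → ℝ}

/-- **RELAY TAIL STEP.** Along a pseudo-flow (`ε₀ = 1`, any defect constants) of a cancelling table
with the completion-relay rows, let `E₀ ≥ 0` bound every partial sum of the start energies over the
shells `k ≥ K`, and let `g` be a continuous majorant on `[0, t] ⊆ [0, τ]` of the relay-flux weight of
the lower shell, `2^{5(K−1)/2}·(u_{K−1}(u)² + |r_{K−1}(u)·u_{K−1}(u)|/32) ≤ g(u)`. Then for every
`s ∈ [0, t]`: `√(Σᵢ F_{i,K}(s)) ≤ √E₀ + ½ ∫₀ˢ √2·g(u) du`.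
[cite: Tao2016AveragedNS, §4 Lemma 4.1 (4.5), (4.9)–(4.10) with (4.3)] -/
theorem relay_tail_step (h : PseudoFlowOn τ 1 α κ₁ κ₂ S₀ F₀ B₀ S F) (hτ : 0 < τ)
    (hα : IsCancellingCoeff α)
    (hrows : (∀ (X : Fin 4 → ℤ → ℝ → ℝ) (n : ℤ) (t : ℝ), quadTerm 1 α X 0 n t =
        -((1 + 1 : ℝ) ^ ((5 : ℝ) * n / 2) * (X 1 n t * X 1 n t)) +
          (1 + 1 : ℝ) ^ ((5 : ℝ) * ((n : ℝ) - 1) / 2) * (X 1 (n - 1) t * X 1 (n - 1) t)) ∧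
      (∀ (X : Fin 4 → ℤ → ℝ → ℝ) (n : ℤ) (t : ℝ), quadTerm 1 α X 1 n t =
        (1 + 1 : ℝ) ^ ((5 : ℝ) * n / 2) * (X 0 n t * X 1 n t - X 1 n t * X 0 (n + 1) t) -
          (1 / 32 : ℝ) * ((1 + 1 : ℝ) ^ ((5 : ℝ) * n / 2) * (X 0 (n + 1) t * X 2 n t)) +
          (1 / 32 : ℝ) * ((1 + 1 : ℝ) ^ ((5 : ℝ) * ((n : ℝ) - 1) / 2) *
            (X 2 (n - 1) t * X 1 (n - 1) t))) ∧
      (∀ (X : Fin 4 → ℤ → ℝ → ℝ) (n : ℤ) (t : ℝ), quadTerm 1 α X 2 n t =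
        (1 / 32 : ℝ) * ((1 + 1 : ℝ) ^ ((5 : ℝ) * n / 2) *
          (X 0 (n + 1) t * X 1 n t - X 1 n t * X 1 (n + 1) t))) ∧
      (∀ (X : Fin 4 → ℤ → ℝ → ℝ) (n : ℤ) (t : ℝ), quadTerm 1 α X 3 n t = 0))
    (K : ℤ) {E₀ : ℝ} (hE₀0 : 0 ≤ E₀)
    (hE₀ : ∀ L : ℕ, ∑ k ∈ Finset.range L, ∑ i, F₀ i (K + k) ≤ E₀)
    {t : ℝ} (ht : t ∈ Icc 0 τ) {g : ℝ → ℝ} (hg : ContinuousOn g (Icc 0 t))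
    (hflux : ∀ u ∈ Icc 0 t,
      (1 + 1 : ℝ) ^ ((5 : ℝ) * ((K - 1 : ℤ) : ℝ) / 2) *
        (S 1 (K - 1) u ^ 2 + |S 2 (K - 1) u * S 1 (K - 1) u| / 32) ≤ g u) :
    ∀ s ∈ Icc 0 t, Real.sqrt (∑ i, F i K s) ≤
      Real.sqrt E₀ + 1 / 2 * ∫ u in (0 : ℝ)..s, Real.sqrt 2 * g u := by
  have hsubt : Icc 0 t ⊆ Icc 0 τ := Icc_subset_Icc_right ht.2
  have hS : ∀ i n, ContinuousOn (S i n) (Icc 0 τ) := fun i n => (h.contDiffOn_S i n).continuousOn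
  have hFc : ∀ i n, ContinuousOn (F i n) (Icc 0 τ) := fun i n => (h.contDiffOn_F i n).continuousOn
  -- the energy of shell K and the driving weight
  set y : ℝ → ℝ := fun u => ∑ i, F i K u with hy
  set g' : ℝ → ℝ := fun u => Real.sqrt 2 * g u with hg'
  have hy_cont : ContinuousOn y (Icc 0 t) := (continuousOn_finsetSum _ fun i _ => hFc i K).mono hsubt
  have hg'_cont : ContinuousOn g' (Icc 0 t) := continuousOn_const.mul hg
  have hΛ : 0 ≤ (1 + 1 : ℝ) ^ ((5 : ℝ) * ((K - 1 : ℤ) : ℝ) / 2) :=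
    (Real.rpow_pos_of_pos (by norm_num) _).le
  have hg0 : ∀ u ∈ Icc 0 t, 0 ≤ g u := fun u hu =>
    le_trans (by positivity) (hflux u hu)
  have hg'0 : ∀ u ∈ Icc 0 t, 0 ≤ g' u := fun u hu => by
    simp only [hg']; exact mul_nonneg (Real.sqrt_nonneg _) (hg0 u hu)
  -- amplitudes of shell K by its energy
  have hQ : ∀ u ∈ Icc 0 τ, ∀ i, |S i K u| ≤ Real.sqrt 2 * Real.sqrt (y u) := by
    intro u hu i
    have h1 : F i K u ≤ y u :=
      Finset.single_le_sum (f := fun j => F j K u) (fun j _ => h.nonneg_F j K u hu) (Finset.mem_univ i)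
    rw [← Real.sqrt_mul (by norm_num)]
    exact Real.abs_le_sqrt (by linarith [h.defect_lower i K u hu])
  -- the integral inequality y ≤ E₀ + ∫ g' √y on [0, t]
  have hle : ∀ x ∈ Icc 0 t, y x ≤ E₀ + ∫ u in (0 : ℝ)..x, g' u * Real.sqrt (y u) := by
    intro x hx
    have hxτ : x ∈ Icc 0 τ := hsubt hx
    have hsubx : uIcc 0 x ⊆ Icc 0 t := by
      rw [uIcc_of_le hx.1]
      exact Icc_subset_Icc_right hx.2
    have h1 : y x ≤ E₀ + ∫ u in (0 : ℝ)..x, botSum 1 α S (K - 1) u := by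
      have := pseudoFlowOn_shell_energy_le_tail h hτ one_pos hα K hE₀ (le_refl K) hxτ
      simpa only [hy] using this
    have hbint : IntervalIntegrable (fun u => botSum 1 α S (K - 1) u) volume 0 x :=
      ((continuousOn_botSum 1 α hS (K - 1)).mono (hsubx.trans hsubt)).intervalIntegrable
    have hgyint : IntervalIntegrable (fun u => g' u * Real.sqrt (y u)) volume 0 x :=
      ((hg'_cont.mul hy_cont.sqrt).mono hsubx).intervalIntegrable
    have h2 : ∫ u in (0 : ℝ)..x, botSum 1 α S (K - 1) u ≤
        ∫ u in (0 : ℝ)..x, g' u * Real.sqrt (y u) := by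
      refine intervalIntegral.integral_mono_on hx.1 hbint hgyint fun u hu => ?_
      have hut : u ∈ Icc 0 t := ⟨hu.1, hu.2.trans hx.2⟩
      have huτ : u ∈ Icc 0 τ := hsubt hut
      have hK : K - 1 + 1 = K := sub_add_cancel K 1
      have hx0 : |S 0 (K - 1 + 1) u| ≤ Real.sqrt 2 * Real.sqrt (y u) := by
        rw [hK]; exact hQ u huτ 0
      have hu1 : |S 1 (K - 1 + 1) u| ≤ Real.sqrt 2 * Real.sqrt (y u) := by
        rw [hK]; exact hQ u huτ 1
      have hb := abs_botSum_relay_le hα hrows S (K - 1) u hx0 hu1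
      have hyu : 0 ≤ Real.sqrt 2 * Real.sqrt (y u) := by positivity
      calc botSum 1 α S (K - 1) u ≤ |botSum 1 α S (K - 1) u| := le_abs_self _
        _ ≤ (1 + 1 : ℝ) ^ ((5 : ℝ) * ((K - 1 : ℤ) : ℝ) / 2) *
              (S 1 (K - 1) u ^ 2 + |S 2 (K - 1) u * S 1 (K - 1) u| / 32) *
              (Real.sqrt 2 * Real.sqrt (y u)) := hb
        _ ≤ g u * (Real.sqrt 2 * Real.sqrt (y u)) :=
            mul_le_mul_of_nonneg_right (hflux u hut) hyu
        _ = g' u * Real.sqrt (y u) := by simp only [hg']; ring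
    linarith
  intro s hs
  have := sqrt_le_sqrt_add_half_integral hy_cont hg'_cont hg'0 hE₀0 hle s hs
  simpa only [hy, hg'] using this

/-- **Relay tail step driven by the previous shell's energy.** If on `[0, t]` the energy of shell
`K−1` is at most `β` (`Σᵢ F_{i,K−1} ≤ β`), the relay-flux weight is at most
`2^{5(K−1)/2}·(65/32)·β` (`u² ≤ 2F_u`, `|ru| ≤ F_r + F_u`), and the step gives the explicit bound
`√(Σᵢ F_{i,K}(s)) ≤ √E₀ + (√2/2)·2^{5(K−1)/2}·(65/32)·β·s`.
[cite: Tao2016AveragedNS, §4 Lemma 4.1 (4.5), (4.9)–(4.10) with (4.3)] -/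
theorem relay_tail_step_of_energy_le (h : PseudoFlowOn τ 1 α κ₁ κ₂ S₀ F₀ B₀ S F) (hτ : 0 < τ)
    (hα : IsCancellingCoeff α)
    (hrows : (∀ (X : Fin 4 → ℤ → ℝ → ℝ) (n : ℤ) (t : ℝ), quadTerm 1 α X 0 n t =
        -((1 + 1 : ℝ) ^ ((5 : ℝ) * n / 2) * (X 1 n t * X 1 n t)) +
          (1 + 1 : ℝ) ^ ((5 : ℝ) * ((n : ℝ) - 1) / 2) * (X 1 (n - 1) t * X 1 (n - 1) t)) ∧
      (∀ (X : Fin 4 → ℤ → ℝ → ℝ) (n : ℤ) (t : ℝ), quadTerm 1 α X 1 n t =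
        (1 + 1 : ℝ) ^ ((5 : ℝ) * n / 2) * (X 0 n t * X 1 n t - X 1 n t * X 0 (n + 1) t) -
          (1 / 32 : ℝ) * ((1 + 1 : ℝ) ^ ((5 : ℝ) * n / 2) * (X 0 (n + 1) t * X 2 n t)) +
          (1 / 32 : ℝ) * ((1 + 1 : ℝ) ^ ((5 : ℝ) * ((n : ℝ) - 1) / 2) *
            (X 2 (n - 1) t * X 1 (n - 1) t))) ∧
      (∀ (X : Fin 4 → ℤ → ℝ → ℝ) (n : ℤ) (t : ℝ), quadTerm 1 α X 2 n t =
        (1 / 32 : ℝ) * ((1 + 1 : ℝ) ^ ((5 : ℝ) * n / 2) *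
          (X 0 (n + 1) t * X 1 n t - X 1 n t * X 1 (n + 1) t))) ∧
      (∀ (X : Fin 4 → ℤ → ℝ → ℝ) (n : ℤ) (t : ℝ), quadTerm 1 α X 3 n t = 0))
    (K : ℤ) {E₀ : ℝ} (hE₀0 : 0 ≤ E₀)
    (hE₀ : ∀ L : ℕ, ∑ k ∈ Finset.range L, ∑ i, F₀ i (K + k) ≤ E₀)
    {t : ℝ} (ht : t ∈ Icc 0 τ) {β : ℝ}
    (hβ : ∀ u ∈ Icc 0 t, ∑ i, F i (K - 1) u ≤ β) :
    ∀ s ∈ Icc 0 t, Real.sqrt (∑ i, F i K s) ≤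
      Real.sqrt E₀ + Real.sqrt 2 / 2 * ((1 + 1 : ℝ) ^ ((5 : ℝ) * ((K - 1 : ℤ) : ℝ) / 2) *
        ((65 / 32) * β)) * s := by
  have hsubt : Icc 0 t ⊆ Icc 0 τ := Icc_subset_Icc_right ht.2
  set Λ : ℝ := (1 + 1 : ℝ) ^ ((5 : ℝ) * ((K - 1 : ℤ) : ℝ) / 2) with hΛdef
  have hΛ : 0 ≤ Λ := (Real.rpow_pos_of_pos (by norm_num) _).le
  -- the weight of the lower shell by its energy
  have hw : ∀ u ∈ Icc 0 t,
      Λ * (S 1 (K - 1) u ^ 2 + |S 2 (K - 1) u * S 1 (K - 1) u| / 32) ≤ Λ * ((65 / 32) * β) := by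
    intro u hu
    have huτ := hsubt hu
    have hF1 : F 1 (K - 1) u ≤ ∑ i, F i (K - 1) u :=
      Finset.single_le_sum (f := fun j => F j (K - 1) u) (fun j _ => h.nonneg_F j (K - 1) u huτ)
        (Finset.mem_univ 1)
    have hF2 : F 2 (K - 1) u ≤ ∑ i, F i (K - 1) u :=
      Finset.single_le_sum (f := fun j => F j (K - 1) u) (fun j _ => h.nonneg_F j (K - 1) u huτ)
        (Finset.mem_univ 2)
    have hF12 : F 1 (K - 1) u + F 2 (K - 1) u ≤ ∑ i, F i (K - 1) u := by
      rw [Fin.sum_univ_four]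
      linarith [h.nonneg_F 0 (K - 1) u huτ, h.nonneg_F 3 (K - 1) u huτ]
    have hu2 : S 1 (K - 1) u ^ 2 ≤ 2 * F 1 (K - 1) u := by
      linarith [h.defect_lower 1 (K - 1) u huτ]
    have hr2 : S 2 (K - 1) u ^ 2 ≤ 2 * F 2 (K - 1) u := by
      linarith [h.defect_lower 2 (K - 1) u huτ]
    have hru : |S 2 (K - 1) u * S 1 (K - 1) u| ≤ F 2 (K - 1) u + F 1 (K - 1) u := by
      rw [abs_mul]
      nlinarith [abs_nonneg (S 2 (K - 1) u), abs_nonneg (S 1 (K - 1) u),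
        sq_abs (S 2 (K - 1) u), sq_abs (S 1 (K - 1) u),
        sq_nonneg (|S 2 (K - 1) u| - |S 1 (K - 1) u|)]
    have hβu := hβ u hu
    refine mul_le_mul_of_nonneg_left ?_ hΛ
    have : S 1 (K - 1) u ^ 2 + |S 2 (K - 1) u * S 1 (K - 1) u| / 32 ≤
        2 * (∑ i, F i (K - 1) u) + (∑ i, F i (K - 1) u) / 32 := by
      have h1 : |S 2 (K - 1) u * S 1 (K - 1) u| / 32 ≤ (∑ i, F i (K - 1) u) / 32 := by
        exact div_le_div_of_nonneg_right (hru.trans (by linarith)) (by norm_num)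
      linarith
    linarith
  have hstep := relay_tail_step h hτ hα hrows K hE₀0 hE₀ ht (continuousOn_const) hw
  intro s hs
  have h1 := hstep s hs
  rw [intervalIntegral.integral_const, smul_eq_mul, sub_zero] at h1
  calc Real.sqrt (∑ i, F i K s)
      ≤ Real.sqrt E₀ + 1 / 2 * (s * (Real.sqrt 2 * (Λ * ((65 / 32) * β)))) := h1
    _ = Real.sqrt E₀ + Real.sqrt 2 / 2 * (Λ * ((65 / 32) * β)) * s := by ring

end RelayFrontStep

end Summit.NavierStokesRegularity.NavierStokesRegularity.Theorems
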